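import Mathlib
import Summits.NavierStokesRegularity.NavierStokesRegularity.Theorems.FilamentSkeletonRssAreaLawSlavingHoloStadiumAreaOfRealSlip

/-!
# Area-law slaving, complex part 13 — Γ-UNIFORMITY: a waist-scaled analytic slip meets the capstone with Γ-free constants
# (`FilamentSkeletonRss`, child crux `TangentSkeletonNearStraight`, stmt-NavierStokesRegularity-28295, line
# `child_tangent_analytic_strip`, ∃-side of the registered stub `stub_analyticClosing`: the `StadiumAnalyticArea` conjunct)

The design of the line rests on WAIST SCALING: the zeroth iterate of the scheme has slip `w⁰(τ) = √Γ·W(τ/√Γ)` for a Γ-FREE profile `W`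
(the straight datum's closed-form slip, `Theorems.AreaLawSlaving` parts 8–10), and all later iterates stay close to it.  This file shows
that such a scaled slip meets EVERY hypothesis of the capstone `stadium_analytic_area_of_real_slip` (complex parts 9–10) on the line's
stadium `{|Im z| < cs√Γ, |Re z − √Γ s₀| < L + cs√Γ}` with Γ-free constants, provided the profile `W` extends holomorphically to a
horizontal strip `{|Im s| < σ₀}` (`cs ≤ σ₀`) with `‖W′‖ ≤ M₀`, `‖W″‖ ≤ K₀` there, is real on `ℝ`, vanishes at `s₀` with `Re W′(s₀) > 3/2`,
and has the datum's transversality floor `mw·|x − s₀| ≤ |W x|`: then `K₂ = K₀/√Γ`, `M = M₀`, floor slope `mw`, and the two capstone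
inequalities become the Γ-FREE smallness conditions `cs·K₀ ≤ 1/8`, `8K₀·cs·(18 + 12M₀ + 48Λ) ≤ mw` on the single ∃-side constant `cs`
(plus the fit `√Γ/(8K₀) < L + cs√Γ` of the near rectangle, true for `L = Rb√(Γ log Γ)` and `Γ` large, `Theorems.StadiumLargeGamma`).
Consequently the slaved area of ANY such slip (area law on `ℝ`, floor `Λ⁻¹ ≤ Aa`) is `StadiumAnalyticArea (cs√Γ) L (√Γ s₀) Aa` for
every `Γ ≥ 1` — Γ-uniformly, which is what the two-phase scheme needs of its invariant.

* `scaledSlip_hasDerivAt`, `scaledSlip_deriv2` — derivatives of `z ↦ √Γ·W(z/√Γ)`;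
* `stadium_analytic_area_of_scaled_slip` — the statement above.

HONEST FRAMING: bookkeeping/complex analysis serving a HYPOTHETICAL filament skeleton on the NEGATIVE side of a MODEL route; no registered stub
is closed by this file and nothing here bears on Navier–Stokes regularity or blow-up.  `--supports stmt-NavierStokesRegularity-28295`.
-/

set_option linter.dupNamespace false

noncomputable section

namespace Summit.NavierStokesRegularity.NavierStokesRegularity.Theorems.AreaLawSlavingHolo

open Set Metric Filter Real
open scoped Topology

/-- The horizontal strip `{|Im s| < σ₀}` is open. [folklore] -/
theorem hstrip_isOpen (σ₀ : ℝ) : IsOpen {s : ℂ | |s.im| < σ₀} :=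
  isOpen_lt (continuous_abs.comp Complex.continuous_im) continuous_const

/-- **Derivative of the scaled slip.**  `W` holomorphic on the strip `{|Im s| < σ₀}`, `0 < r`, `z/r` in the strip:
`z ↦ r·W(z/r)` has derivative `W′(z/r)` at `z`. [folklore] -/
theorem scaledSlip_hasDerivAt {σ₀ r : ℝ} (hr : 0 < r) {W : ℂ → ℂ} (hW : DifferentiableOn ℂ W {s : ℂ | |s.im| < σ₀})
    {z : ℂ} (hz : z / (r : ℂ) ∈ {s : ℂ | |s.im| < σ₀}) :
    HasDerivAt (fun y : ℂ => (r : ℂ) * W (y / (r : ℂ))) (deriv W (z / (r : ℂ))) z := by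
  have hr' : (r : ℂ) ≠ 0 := by exact_mod_cast hr.ne'
  have h1 : HasDerivAt W (deriv W (z / (r : ℂ))) (z / (r : ℂ)) :=
    (hW.differentiableAt ((hstrip_isOpen σ₀).mem_nhds hz)).hasDerivAt
  have h2 : HasDerivAt (fun y : ℂ => y / (r : ℂ)) (1 / (r : ℂ)) z := by
    simpa using (hasDerivAt_id z).div_const (r : ℂ)
  have h3 := (h1.comp z h2).const_mul (r : ℂ)
  refine h3.congr_deriv ?_
  field_simp

/-- **Second derivative of the scaled slip**: `(r·W(·/r))″(z) = W″(z/r)/r` at points `z` of an open set mapped into the strip.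
[folklore] -/
theorem scaledSlip_deriv2 {σ₀ r : ℝ} (hr : 0 < r) {W : ℂ → ℂ} (hW : DifferentiableOn ℂ W {s : ℂ | |s.im| < σ₀})
    {U : Set ℂ} (hUo : IsOpen U) (hmap : ∀ y ∈ U, y / (r : ℂ) ∈ {s : ℂ | |s.im| < σ₀}) {z : ℂ} (hz : z ∈ U) :
    deriv (deriv (fun y : ℂ => (r : ℂ) * W (y / (r : ℂ)))) z = deriv (deriv W) (z / (r : ℂ)) / (r : ℂ) := by
  have hr' : (r : ℂ) ≠ 0 := by exact_mod_cast hr.ne'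
  -- `deriv (r·W(·/r)) = W′(·/r)` near `z`
  have hev : deriv (fun y : ℂ => (r : ℂ) * W (y / (r : ℂ))) =ᶠ[𝓝 z] fun y => deriv W (y / (r : ℂ)) :=
    Filter.eventually_of_mem (hUo.mem_nhds hz) (fun y hy => (scaledSlip_hasDerivAt hr hW (hmap y hy)).deriv)
  rw [hev.deriv_eq]
  have hW' : DifferentiableOn ℂ (deriv W) {s : ℂ | |s.im| < σ₀} := (hW.analyticOnNhd (hstrip_isOpen σ₀)).deriv.differentiableOn
  have h1 : HasDerivAt (deriv W) (deriv (deriv W) (z / (r : ℂ))) (z / (r : ℂ)) :=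
    (hW'.differentiableAt ((hstrip_isOpen σ₀).mem_nhds (hmap z hz))).hasDerivAt
  have h2 : HasDerivAt (fun y : ℂ => y / (r : ℂ)) (1 / (r : ℂ)) z := by
    simpa using (hasDerivAt_id z).div_const (r : ℂ)
  have h3 : HasDerivAt (deriv W ∘ fun y : ℂ => y / (r : ℂ)) (deriv (deriv W) (z / (r : ℂ)) * (1 / (r : ℂ))) z :=
    h1.comp z h2
  have h4 : deriv (fun y : ℂ => deriv W (y / (r : ℂ))) z = deriv (deriv W) (z / (r : ℂ)) * (1 / (r : ℂ)) := h3.deriv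
  rw [h4]
  field_simp

/-- **Γ-uniform `StadiumAnalyticArea` for a waist-scaled analytic slip.**  See the module docstring.  `wj` is the real scaled slip
`wj τ = √Γ·Re W(τ/√Γ)` and `Aa` its slaved area (area law on `ℝ`, floor `Λ⁻¹ ≤ Aa`). [folklore] -/
theorem stadium_analytic_area_of_scaled_slip {σ₀ M₀ K₀ mw s₀ cs Γ L Λ : ℝ} {W : ℂ → ℂ}
    (hΓ : 1 ≤ Γ) (hcs : 0 < cs) (hcsσ : cs ≤ σ₀) (hK₀ : 0 < K₀) (hmw : 0 < mw) (hΛ : 0 < Λ)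
    (hW : DifferentiableOn ℂ W {s : ℂ | |s.im| < σ₀}) (hW_re : ∀ x : ℝ, (W x).im = 0)
    (hW0 : W s₀ = 0) (hsup : 3 / 2 < (deriv W s₀).re)
    (hK₀bd : ∀ s ∈ {s : ℂ | |s.im| < σ₀}, ‖deriv (deriv W) s‖ ≤ K₀)
    (hM₀bd : ∀ s ∈ {s : ℂ | |s.im| < σ₀}, ‖deriv W s‖ ≤ M₀)
    (hfloor : ∀ x : ℝ, mw * |x - s₀| ≤ ‖W x‖)
    (hsmall₁ : cs * K₀ ≤ 1 / 8) (hsmall₂ : 8 * K₀ * cs * (18 + 12 * M₀ + 48 * Λ) ≤ mw)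
    (hfit : √Γ / (8 * K₀) < L + cs * √Γ)
    {wj : ℝ → ℝ} (hwj : ∀ τ : ℝ, wj τ = √Γ * (W ((τ / √Γ : ℝ) : ℂ)).re)
    {Aa : ℝ → ℝ} (hAd : Differentiable ℝ Aa) (hlaw : ∀ τ, wj τ * deriv Aa τ = (3 / 2 - deriv wj τ) * Aa τ + 4)
    (hAfloor : ∀ τ, Λ⁻¹ ≤ Aa τ) :
    ∃ G : ℂ → ℂ, DifferentiableOn ℂ G {z : ℂ | |z.im| < cs * √Γ ∧ |z.re - √Γ * s₀| < L + cs * √Γ} ∧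
      (∀ t : ℝ, (t : ℂ) ∈ {z : ℂ | |z.im| < cs * √Γ ∧ |z.re - √Γ * s₀| < L + cs * √Γ} → G t = ((Aa t : ℝ) : ℂ)) ∧
      ∀ z ∈ {z : ℂ | |z.im| < cs * √Γ ∧ |z.re - √Γ * s₀| < L + cs * √Γ},
        Aa z.re / 2 ≤ (G z).re ∧ ‖G z‖ ≤ 2 * Aa z.re := by
  -- constants
  have hΓpos : 0 < Γ := by linarith
  have hsΓ : 0 < √Γ := Real.sqrt_pos.mpr hΓpos
  have hsΓ' : (√Γ : ℂ) ≠ 0 := by exact_mod_cast hsΓ.ne'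
  obtain ⟨U, hU⟩ : ∃ U : Set ℂ, U = {z : ℂ | |z.im| < cs * √Γ ∧ |z.re - √Γ * s₀| < L + cs * √Γ} := ⟨_, rfl⟩
  have hUo : IsOpen U := by rw [hU]; exact thinStadium_isOpen _ _ _
  have hmemU : ∀ z : ℂ, z ∈ U ↔ |z.im| < cs * √Γ ∧ |z.re - √Γ * s₀| < L + cs * √Γ := by intro z; rw [hU]; rfl
  -- the stadium is mapped into the strip by `z ↦ z/√Γ`
  have hmap : ∀ y ∈ U, y / ((√Γ : ℝ) : ℂ) ∈ {s : ℂ | |s.im| < σ₀} := by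
    intro y hy
    have hy' := (hmemU y).1 hy
    show |(y / ((√Γ : ℝ) : ℂ)).im| < σ₀
    rw [Complex.div_ofReal_im, abs_div, abs_of_pos hsΓ, div_lt_iff₀ hsΓ]
    calc |y.im| < cs * √Γ := hy'.1
      _ ≤ σ₀ * √Γ := mul_le_mul_of_nonneg_right hcsσ hsΓ.le
  -- the scaled slip on the stadium
  obtain ⟨Ws, hWs⟩ : ∃ Ws : ℂ → ℂ, Ws = fun y : ℂ => ((√Γ : ℝ) : ℂ) * W (y / ((√Γ : ℝ) : ℂ)) := ⟨_, rfl⟩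
  have hWsd : ∀ z ∈ U, HasDerivAt Ws (deriv W (z / ((√Γ : ℝ) : ℂ))) z := by
    intro z hz; rw [hWs]; exact scaledSlip_hasDerivAt hsΓ hW (hmap z hz)
  have hWsD : DifferentiableOn ℂ Ws U := fun z hz => (hWsd z hz).differentiableAt.differentiableWithinAt
  have hWs' : ∀ z ∈ U, deriv Ws z = deriv W (z / ((√Γ : ℝ) : ℂ)) := fun z hz => (hWsd z hz).deriv
  have hWs'' : ∀ z ∈ U, deriv (deriv Ws) z = deriv (deriv W) (z / ((√Γ : ℝ) : ℂ)) / ((√Γ : ℝ) : ℂ) := by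
    intro z hz; rw [hWs]; exact scaledSlip_deriv2 hsΓ hW hUo hmap hz
  -- bounds `K₂ = K₀/√Γ`, `M = M₀`
  have hK₂ : ∀ ζ ∈ U, ‖deriv (deriv Ws) ζ‖ ≤ K₀ / √Γ := by
    intro ζ hζ
    rw [hWs'' ζ hζ, norm_div, Complex.norm_real, Real.norm_eq_abs, abs_of_pos hsΓ]
    exact div_le_div_of_nonneg_right (hK₀bd _ (hmap ζ hζ)) hsΓ.le
  have hM : ∀ ζ ∈ U, ‖deriv Ws ζ‖ ≤ M₀ := fun ζ hζ => by rw [hWs' ζ hζ]; exact hM₀bd _ (hmap ζ hζ)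
  -- real trace
  have hdivreal : ∀ x : ℝ, (x : ℂ) / ((√Γ : ℝ) : ℂ) = ((x / √Γ : ℝ) : ℂ) := fun x => by push_cast; ring
  have htr : ∀ x : ℝ, (x : ℂ) ∈ U → (Ws x).re = wj x := by
    intro x _
    rw [hwj x, hWs]
    simp only [hdivreal x, Complex.re_ofReal_mul]
  have him : ∀ x : ℝ, (x : ℂ) ∈ U → (Ws x).im = 0 := by
    intro x _
    rw [hWs]
    simp only [hdivreal x, Complex.im_ofReal_mul, hW_re, mul_zero]
  -- the zero `c = √Γ s₀`
  have hcdiv : (((√Γ * s₀ : ℝ) : ℂ)) / ((√Γ : ℝ) : ℂ) = ((s₀ : ℝ) : ℂ) := by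
    push_cast
    field_simp
  have hWsc : Ws ((√Γ * s₀ : ℝ) : ℂ) = 0 := by
    rw [hWs]; simp only [hcdiv, hW0, mul_zero]
  have hcU : (((√Γ * s₀ : ℝ) : ℂ)) ∈ U := by
    rw [hmemU]
    refine ⟨by simpa using mul_pos hcs hsΓ, ?_⟩
    simp only [Complex.ofReal_re, sub_self, abs_zero]
    have : 0 < √Γ / (8 * K₀) := by positivity
    linarith
  have hWsc_re : 3 / 2 < (deriv Ws ((√Γ * s₀ : ℝ) : ℂ)).re := by
    rw [hWs' _ hcU, hcdiv]; exact hsup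
  -- the floor `mw·|x − c| ≤ ‖Ws x‖`
  have hfloor' : ∀ x : ℝ, (x : ℂ) ∈ U → √Γ / (8 * K₀) < |x - √Γ * s₀| → mw * (√Γ / (8 * K₀)) ≤ ‖Ws x‖ := by
    intro x _ hxr
    have h1 : ‖Ws x‖ = √Γ * ‖W ((x / √Γ : ℝ) : ℂ)‖ := by
      rw [hWs]; simp only [hdivreal x, norm_mul, Complex.norm_real, Real.norm_eq_abs, abs_of_pos hsΓ]
    have h2 : √Γ * (mw * |x / √Γ - s₀|) ≤ √Γ * ‖W ((x / √Γ : ℝ) : ℂ)‖ :=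
      mul_le_mul_of_nonneg_left (hfloor (x / √Γ)) hsΓ.le
    have h3 : √Γ * |x / √Γ - s₀| = |x - √Γ * s₀| := by
      rw [← abs_of_pos hsΓ, ← abs_mul, abs_of_pos hsΓ]
      congr 1; field_simp
    have h4 : mw * (√Γ / (8 * K₀)) ≤ mw * |x - √Γ * s₀| := mul_le_mul_of_nonneg_left hxr.le hmw.le
    calc mw * (√Γ / (8 * K₀)) ≤ mw * |x - √Γ * s₀| := h4
      _ = √Γ * (mw * |x / √Γ - s₀|) := by rw [← h3]; ring
      _ ≤ √Γ * ‖W ((x / √Γ : ℝ) : ℂ)‖ := h2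
      _ = ‖Ws x‖ := h1.symm
  -- the two capstone inequalities
  have hK₂r : K₀ / √Γ * (√Γ / (8 * K₀) + cs * √Γ) ≤ 1 / 4 := by
    have : K₀ / √Γ * (√Γ / (8 * K₀) + cs * √Γ) = 1 / 8 + cs * K₀ := by field_simp
    rw [this]; linarith
  have hthin : (18 + 12 * M₀ + 48 / Λ⁻¹) * (cs * √Γ) ≤ mw * (√Γ / (8 * K₀)) := by
    rw [div_inv_eq_mul]
    have h : (18 + 12 * M₀ + 48 * Λ) * (cs * √Γ) * (8 * K₀) ≤ mw * √Γ := by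
      have := mul_le_mul_of_nonneg_right hsmall₂ hsΓ.le
      calc (18 + 12 * M₀ + 48 * Λ) * (cs * √Γ) * (8 * K₀) = 8 * K₀ * cs * (18 + 12 * M₀ + 48 * Λ) * √Γ := by ring
        _ ≤ mw * √Γ := this
    have hmw' : mw * (√Γ / (8 * K₀)) = mw * √Γ / (8 * K₀) := by ring
    rw [hmw', le_div_iff₀ (by positivity : (0:ℝ) < 8 * K₀)]
    exact h
  have hrect : |√Γ * s₀ - √Γ * s₀| + √Γ / (8 * K₀) < L + cs * √Γ := by
    rw [sub_self, abs_zero, zero_add]; exact hfit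
  -- the capstone
  have key := stadium_analytic_area_of_real_slip (c := √Γ * s₀) hU (by positivity : (0:ℝ) ≤ √Γ / (8 * K₀)) hrect hWsD
    htr him hWsc hWsc_re hK₂ hK₂r hM (mul_pos hmw (by positivity)) hfloor' (fun x _ => hAd x) (fun x _ => hlaw x)
    (inv_pos.mpr hΛ) (fun x _ => hAfloor x) hthin
  exact key

end Summit.NavierStokesRegularity.NavierStokesRegularity.Theorems.AreaLawSlavingHolo
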